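import Mathlib
import Literature.NumberTheory.LFunctions.Zhang2022.AppendixALemma152Steps
import Literature.NumberTheory.LFunctions.Zhang2022.AppendixALemma152Prep
import HarnessLib

/-!
# Zhang (2022), Appendix A part 2 (iv): the `s`-dependent steps of the proof of Lemma 15.2 DISCHARGED — u021b, u025, u027, (A.6), (A.7)

Topic `Literature/NumberTheory/LFunctions/Zhang2022` (Landau–Siegel audit tree; verdict-neutral).
Y. Zhang, *Discrete mean estimates and the Landau–Siegel zero*, arXiv:2211.02515v1 (2022)
[Zhang2022LandauSiegel] — **an unrefereed manuscript under adjudication**. Continuation of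
`AppendixALemma152Steps`: the typed claims of `TypedAppendixA2` (proof of Lemma 15.2, App. A
pp. 103–104) that carry the complex parameter `s` with `|s − 1| < 5α` — i.e. the factor `q^{−s}` — are
PROVED here for all `D ≥ D₀(c′)`, every prime `q < D` (where the printed range is used only through
`log q ≤ 𝓛`), with explicit absolute constants:

* `stepA_u021b_holds` — `(1−q^{−s−β₁})(1−q^{−s−β₂})/((1−q^{−s})(1−χ(q)q^{−s})) = (1−q⁻¹)/(1−χ(q)q⁻¹)
  + O(α log q/q)`;
* `stepA_u025_holds` — `Σ_r q^{−rs}(κ̃₁(qʳ,1) − χ(q)q(q−1)⁻¹κ₁(q^{r−1})) = u(1−u)⁻¹(1/(1−vu) − v/(1−u))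
  + O(α log q/q)`;
* `stepA_u027_holds` — `1 + λ₁(q)·[that sum] = 1/(1−u) − uv(1−vu)/(1−u)² + O(α log q/q)`;
* `eqA6_holds`, `eqA7_holds` — **(A.6)** for `(q,D) = 1` and **(A.7)** for `q ∣ D`.

Mechanism (the source's "`q^{−s}` with `|s−1| < 5α`"): `q^{−s} = q⁻¹·exp(−(s−1)log q)` and
`|exp z − 1| ≤ 2|z|` for `|z| ≤ 1` give `|q^{−s} − q⁻¹| ≤ 2q⁻¹|s−1|log q ≤ 10αq⁻¹log q`
(`norm_cpow_neg_sub_inv_le`); everything else is the `s = 1` kit of `AppendixALocalSeries` with the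
free decay parameter `w = q^{−s}`. Hypothesis (A) is never used.

## References

* Y. Zhang, arXiv:2211.02515v1 (2022), Appendix A pp. 103–104 (proof of Lemma 15.2), (A.6), (A.7).
  [cite: Zhang2022LandauSiegel, Appendix A]
-/

noncomputable section

open Finset Real Complex ArithmeticFunction

namespace Literature.NumberTheory.LFunctions.Zhang2022.AppendixALocal

open MeanSquareMajorant (powI kappa₁)
open Skeleton (ell alpha bigP b1 b2 beta1 beta2 nset ForAllLarge)
-- OBJECTS: §15 objects of `Typed.AppendixA2` = `Typed.Section15A`'s (merge revision p414212);
-- `sumA6`, `zetaFactor1` are `Typed.AppendixA2`'s own.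
open Typed.Section15A (kappa1 kappaTilde1 lam1)
open Typed.AppendixA2 (sumA6 zetaFactor1)

/-! ### §1. `q^{−s}` versus `q⁻¹` -/

/-- **`|q^{−s} − q⁻¹| ≤ 2q⁻¹|s − 1| log q`** whenever `|s − 1| log q ≤ 1` (`q ≥ 1`):
`q^{−s} = q⁻¹ e^{−(s−1) log q}` and `|e^z − 1| ≤ 2|z|` for `|z| ≤ 1`.
[cite: Zhang2022LandauSiegel, App. A p. 103 ("|s − 1| < 5α")] -/
theorem norm_cpow_neg_sub_inv_le {q : ℕ} (hq : 0 < q) {s : ℂ} (hs : ‖s - 1‖ * Real.log q ≤ 1) :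
    ‖(q : ℂ) ^ (-s) - (q : ℂ)⁻¹‖ ≤ 2 * (q : ℝ)⁻¹ * (‖s - 1‖ * Real.log q) := by
  have hq0 : (q : ℂ) ≠ 0 := by exact_mod_cast hq.ne'
  have hlog : 0 ≤ Real.log q := Real.log_natCast_nonneg q
  have e : (q : ℂ) ^ (-s) = (q : ℂ)⁻¹ * Complex.exp (Complex.log q * (-(s - 1))) := by
    rw [show -s = -1 + (-(s - 1)) by ring, Complex.cpow_add _ _ hq0, Complex.cpow_neg_one,
      Complex.cpow_def_of_ne_zero hq0]
  have hz : ‖Complex.log q * (-(s - 1))‖ = ‖s - 1‖ * Real.log q := by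
    rw [norm_mul, norm_neg, ← Complex.natCast_log, Complex.norm_real, Real.norm_eq_abs,
      abs_of_nonneg hlog, mul_comm]
  rw [e, ← mul_sub_one, norm_mul, norm_inv_natCast]
  have h1 := Complex.norm_exp_sub_one_le (x := Complex.log q * (-(s - 1))) (by rw [hz]; exact hs)
  rw [hz] at h1
  calc (q : ℝ)⁻¹ * ‖Complex.exp (Complex.log q * -(s - 1)) - 1‖
      ≤ (q : ℝ)⁻¹ * (2 * (‖s - 1‖ * Real.log q)) := by gcongr
    _ = 2 * (q : ℝ)⁻¹ * (‖s - 1‖ * Real.log q) := by ring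

/-- The standing estimates at a prime `q < D` for `|s − 1| < 5α`, `D ≥ D₀(c′)`: with `w = q^{−s}`,
`u = q⁻¹`: `|w − u| ≤ 10αu log q`, `|w − u| ≤ u/20`, `|w| ≤ 2u`, `|w| ≤ 3/5`, and
`(|b₁|+|b₂|) log q ≤ 4α log q ≤ 1`. [cite: Zhang2022LandauSiegel, App. A p. 103] -/
theorem local_estimates (c' : ℝ) {D : ℕ} (hD : ⌈Real.exp (7 * π * |c'| + 32)⌉₊ + 1 ≤ D) {q : ℕ}
    (hq : q.Prime) (hqD : q < D) {s : ℂ} (hs : ‖s - 1‖ < 5 * alpha D) :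
    ‖(q : ℂ) ^ (-s) - (q : ℂ)⁻¹‖ ≤ 10 * (q : ℝ)⁻¹ * (alpha D * Real.log q) ∧
      ‖(q : ℂ) ^ (-s) - (q : ℂ)⁻¹‖ ≤ (q : ℝ)⁻¹ / 20 ∧
      ‖(q : ℂ) ^ (-s)‖ ≤ 2 * (q : ℝ)⁻¹ ∧ ‖(q : ℂ) ^ (-s)‖ ≤ 3 / 5 ∧
      (|b1 c' D| + |b2 c' D|) * Real.log q ≤ 1 ∧ Real.log q ≤ ell D := by
  obtain ⟨hℓ, hb, h200, hα0⟩ := threshold c' hD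
  have hq0 : (0 : ℝ) < q := by exact_mod_cast hq.pos
  have hlog : 0 ≤ Real.log q := Real.log_natCast_nonneg q
  have hlogD : Real.log q ≤ ell D := by
    rw [ell]; exact Real.log_le_log hq0 (by exact_mod_cast hqD.le)
  have hδ : ‖s - 1‖ * Real.log q ≤ 5 * (alpha D * Real.log q) := by nlinarith [hs.le]
  have hαq : alpha D * Real.log q ≤ alpha D * ell D := by gcongr
  have hsmall : ‖s - 1‖ * Real.log q ≤ 1 := by nlinarith
  have h1 := norm_cpow_neg_sub_inv_le hq.pos hsmall
  have hu : ‖(q : ℂ)⁻¹‖ = (q : ℝ)⁻¹ := norm_inv_natCast q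
  have hu0 : 0 < (q : ℝ)⁻¹ := by positivity
  have hA : ‖(q : ℂ) ^ (-s) - (q : ℂ)⁻¹‖ ≤ 10 * (q : ℝ)⁻¹ * (alpha D * Real.log q) := by
    calc _ ≤ 2 * (q : ℝ)⁻¹ * (‖s - 1‖ * Real.log q) := h1
      _ ≤ 2 * (q : ℝ)⁻¹ * (5 * (alpha D * Real.log q)) := by gcongr
      _ = 10 * (q : ℝ)⁻¹ * (alpha D * Real.log q) := by ring
  have hB : ‖(q : ℂ) ^ (-s) - (q : ℂ)⁻¹‖ ≤ (q : ℝ)⁻¹ / 20 := by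
    calc _ ≤ 10 * (q : ℝ)⁻¹ * (alpha D * Real.log q) := hA
      _ ≤ 10 * (q : ℝ)⁻¹ * (alpha D * ell D) := by gcongr
      _ ≤ 10 * (q : ℝ)⁻¹ * (1 / 200) := by gcongr; linarith
      _ = (q : ℝ)⁻¹ / 20 := by ring
  have hq2 : (q : ℝ)⁻¹ ≤ 1 / 2 := by
    rw [← hu]; exact norm_inv_natCast_le_half hq.two_le
  have hC : ‖(q : ℂ) ^ (-s)‖ ≤ 2 * (q : ℝ)⁻¹ := by
    have : (q : ℂ) ^ (-s) = ((q : ℂ) ^ (-s) - (q : ℂ)⁻¹) + (q : ℂ)⁻¹ := by ring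
    rw [this]
    calc _ ≤ ‖(q : ℂ) ^ (-s) - (q : ℂ)⁻¹‖ + ‖(q : ℂ)⁻¹‖ := norm_add_le _ _
      _ ≤ (q : ℝ)⁻¹ / 20 + (q : ℝ)⁻¹ := by rw [hu]; gcongr
      _ ≤ 2 * (q : ℝ)⁻¹ := by linarith
  refine ⟨hA, hB, hC, ?_, ?_, hlogD⟩
  · have : (q : ℂ) ^ (-s) = ((q : ℂ) ^ (-s) - (q : ℂ)⁻¹) + (q : ℂ)⁻¹ := by ring
    rw [this]
    calc _ ≤ ‖(q : ℂ) ^ (-s) - (q : ℂ)⁻¹‖ + ‖(q : ℂ)⁻¹‖ := norm_add_le _ _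
      _ ≤ (q : ℝ)⁻¹ / 20 + (q : ℝ)⁻¹ := by rw [hu]; gcongr
      _ ≤ (1 / 2) / 20 + 1 / 2 := by gcongr
      _ ≤ 3 / 5 := by norm_num
  · calc (|b1 c' D| + |b2 c' D|) * Real.log q ≤ (4 * alpha D) * ell D := by gcongr
      _ ≤ 1 := by linarith

/-! ### §2. The `r`-sum `sumA6` in the local variables -/

/-- `χ(q)q/(q − 1) = χ(q)/(1 − q⁻¹)` (`q ≥ 2`). [cite: Zhang2022LandauSiegel, App. A (A.5) p. 103] -/
theorem chi_mul_div_eq {D : ℕ} (χ : DirichletCharacter ℂ D) {q : ℕ} (hq : 2 ≤ q) :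
    χ (q : ZMod D) * (q : ℂ) / ((q : ℂ) - 1) = χ (q : ZMod D) / (1 - (q : ℂ)⁻¹) := by
  have hq0 : (q : ℂ) ≠ 0 := by exact_mod_cast (by omega : q ≠ 0)
  have hq1 : (q : ℂ) - 1 ≠ 0 := sub_ne_zero.mpr (by exact_mod_cast (show q ≠ 1 by omega))
  have hq1' : (1 : ℂ) - (q : ℂ)⁻¹ ≠ 0 := by
    rw [sub_ne_zero, ne_comm, ne_eq, inv_eq_one]
    exact_mod_cast (by omega : q ≠ 1)
  field_simp

/-- **The typed `sumA6` IS the local `r`-sum** of `AppendixALocalSeries` with `w = q^{−s}`: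
`sumA6 q s = Σ_{r≥0} w^{r+1}((Σ_k κ₁(q^{r+1+k})(vu)ᵏ) − (v/(1−u))κ₁(qʳ))` (`q` prime; the typed series
runs over `r ≥ 1` with an `if r = 0` guard — reindexed by `r ↦ r + 1`).
[cite: Zhang2022LandauSiegel, App. A (A.6) p. 103] -/
theorem sumA6_eq (c' : ℝ) {D : ℕ} [NeZero D] (χ : DirichletCharacter ℂ D) {q : ℕ} (hq : q.Prime)
    (s : ℂ) :
    sumA6 c' χ q s = ∑' r : ℕ, ((q : ℂ) ^ (-s)) ^ (r + 1) *
      ((∑' k : ℕ, kappa₁ (b1 c' D) (b2 c' D) (q ^ (r + 1 + k)) * (χ (q : ZMod D) * (q : ℂ)⁻¹) ^ k) -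
        χ (q : ZMod D) / (1 - (q : ℂ)⁻¹) * kappa₁ (b1 c' D) (b2 c' D) (q ^ r)) := by
  rw [sumA6]
  set F : ℕ → ℂ := fun r => if r = 0 then 0 else
      (kappaTilde1 c' χ (q ^ r) 1 1 -
          χ (q : ZMod D) * (q : ℂ) / ((q : ℂ) - 1) * kappa1 c' D (q ^ (r - 1))) /
        (q : ℂ) ^ ((r : ℂ) * s) with hF
  have hsupp : Function.support F ⊆ Set.range Nat.succ := by
    intro r hr
    rw [Function.mem_support] at hr
    rcases Nat.eq_zero_or_pos r with h0 | hpos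
    · exact absurd (by rw [hF]; simp [h0]) hr
    · exact ⟨r - 1, Nat.succ_pred_eq_of_pos hpos⟩
  rw [← Nat.succ_injective.tsum_eq hsupp]
  refine tsum_congr fun r => ?_
  rw [hF]
  simp only [Nat.succ_eq_add_one, Nat.add_sub_cancel, Nat.succ_ne_zero, if_false]
  rw [kappaTilde1_prime_pow_eq c' χ hq (by omega), chi_mul_div_eq χ hq.two_le,
    Complex.cpow_nat_mul, div_eq_mul_inv, ← inv_pow, ← Complex.cpow_neg, mul_comm]
  rfl

/-! ### §3. `Z22:§A.u025`, `Z22:§A.u027`, (A.6), (A.7) -/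

/-- **`Z22:§A.u025` DISCHARGED**: for `D ≥ D₀(c′)`, every prime `q < D` and `|s−1| < 5α`,
`|sumA6 − u(1−u)⁻¹(1/(1−vu) − v/(1−u))| ≤ 504·α log q/q`.
[cite: Zhang2022LandauSiegel, App. A p. 104 (proof of Lemma 15.2)] -/
theorem stepA_u025_holds (c' : ℝ) : Typed.AppendixA2.StepA_u025 c' := by
  refine ⟨504, ForAllLarge.of_le (⌈Real.exp (7 * π * |c'| + 32)⌉₊ + 1) ?_⟩
  intro D _ χ hD _ _ _ q s hq hqD hs
  obtain ⟨-, hb, -, hα0⟩ := threshold c' hD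
  obtain ⟨hwu, -, hw2, hw35, hBL, -⟩ := local_estimates c' hD hq hqD hs
  have hv : ‖χ (q : ZMod D)‖ ≤ 1 := χ.norm_le_one _
  have hu : ‖(q : ℂ)⁻¹‖ ≤ 1 / 2 := norm_inv_natCast_le_half hq.two_le
  have hlog : 0 ≤ Real.log q := Real.log_natCast_nonneg q
  have hq0 : (0 : ℝ) < q := by exact_mod_cast hq.pos
  set w : ℂ := (q : ℂ) ^ (-s) with hw_def
  set u : ℂ := (q : ℂ)⁻¹ with hu_def
  set v : ℂ := χ (q : ZMod D) with hv_def
  set A : ℂ := 1 / (1 - v * u) - v / (1 - u) with hA_def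
  set B : ℝ := (|b1 c' D| + |b2 c' D|) * Real.log q with hB_def
  have hB0 : 0 ≤ B := by rw [hB_def]; positivity
  have hmain := norm_rSumLocal_sub_le (b1 c' D) (b2 c' D) hv hq hw35
  rw [← sumA6_eq c' χ hq s] at hmain
  have hA4 : ‖A‖ ≤ 4 := by
    have hvu : ‖v * u‖ ≤ 1 / 2 := by rw [hu_def]; exact norm_mul_inv_le_half hv hq.two_le
    have hden : (1 : ℝ) / 2 ≤ ‖(1 : ℂ) - v * u‖ := by
      have := norm_sub_norm_le (1 : ℂ) (v * u); rw [norm_one] at this; linarith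
    have hA1 : ‖(1 : ℂ) / (1 - v * u)‖ ≤ 2 := by
      rw [norm_div, norm_one]
      calc 1 / ‖(1 : ℂ) - v * u‖ ≤ 1 / (1 / 2) := by gcongr
        _ = 2 := by norm_num
    have hA2 : ‖v / (1 - u)‖ ≤ 2 := norm_div_one_sub_le_two hu hv
    calc ‖A‖ ≤ ‖(1 : ℂ) / (1 - v * u)‖ + ‖v / (1 - u)‖ := norm_sub_le _ _
      _ ≤ 2 + 2 := by gcongr
      _ = 4 := by norm_num
  have hfrac := norm_div_one_sub_sub_le hw35 hu
  -- `sumA6 − (u/(1−u))A = (sumA6 − A w/(1−w)) + A (w/(1−w) − u/(1−u))`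
  have e : sumA6 c' χ q s - u / (1 - u) * A =
      (sumA6 c' χ q s - A * (w / (1 - w))) + A * (w / (1 - w) - u / (1 - u)) := by ring
  rw [e]
  have hwu' : ‖w - u‖ ≤ 10 * (q : ℝ)⁻¹ * (alpha D * Real.log q) := hwu
  calc ‖(sumA6 c' χ q s - A * (w / (1 - w))) + A * (w / (1 - w) - u / (1 - u))‖
      ≤ ‖sumA6 c' χ q s - A * (w / (1 - w))‖ + ‖A * (w / (1 - w) - u / (1 - u))‖ := norm_add_le _ _
    _ ≤ 38 * B * ‖w‖ + ‖A‖ * (5 * ‖w - u‖) := by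
        rw [norm_mul]; gcongr
    _ ≤ 38 * ((4 * alpha D) * Real.log q) * (2 * (q : ℝ)⁻¹) +
        4 * (5 * (10 * (q : ℝ)⁻¹ * (alpha D * Real.log q))) := by
        gcongr
        calc B = (|b1 c' D| + |b2 c' D|) * Real.log q := hB_def
          _ ≤ (4 * alpha D) * Real.log q := by gcongr
    _ = 504 * (alpha D * Real.log q / q) := by field_simp; ring

variable (c' : ℝ) in
/-- `StepA_u025` — `_holds` alias of `stepA_u025_holds` above under the fact's exact name, stated under the
prover's own binders as section variables (appended 2026-08-28, D-0026 bookkeeping: the proof term is the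
existing theorem of this file; no statement, definition or attribute is edited; no new named fact; the
ledger's debt table listed the fact unproved). [cite: Zhang2022LandauSiegel, App. A p. 104 (proof of Lemma 15.2)] -/
theorem _root_.Literature.NumberTheory.LFunctions.Zhang2022.Typed.AppendixA2.StepA_u025_holds :
    _root_.Literature.NumberTheory.LFunctions.Zhang2022.Typed.AppendixA2.StepA_u025 c' :=
  _root_.Literature.NumberTheory.LFunctions.Zhang2022.AppendixALocal.stepA_u025_holds (c' := c')

/-- **`Z22:§A.u027` DISCHARGED**: for `D ≥ D₀(c′)`, every prime `q < D` and `|s−1| < 5α`,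
`|1 + λ₁(q)·sumA6 − (1/(1−u) − uv(1−vu)/(1−u)²)| ≤ 1524·α log q/q`.
[cite: Zhang2022LandauSiegel, App. A p. 104 (proof of Lemma 15.2)] -/
theorem stepA_u027_holds (c' : ℝ) : Typed.AppendixA2.StepA_u027 c' := by
  refine ⟨1524, ForAllLarge.of_le (⌈Real.exp (7 * π * |c'| + 32)⌉₊ + 1) ?_⟩
  intro D _ χ hD _ _ _ q s hq hqD hs
  obtain ⟨-, hb, -, hα0⟩ := threshold c' hD
  obtain ⟨hwu, -, hw2, hw35, hBL, -⟩ := local_estimates c' hD hq hqD hs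
  have hv : ‖χ (q : ZMod D)‖ ≤ 1 := χ.norm_le_one _
  have hu : ‖(q : ℂ)⁻¹‖ ≤ 1 / 2 := norm_inv_natCast_le_half hq.two_le
  have hlog : 0 ≤ Real.log q := Real.log_natCast_nonneg q
  have hq0 : (0 : ℝ) < q := by exact_mod_cast hq.pos
  have hmain := norm_localA6_sub_le (b1 c' D) (b2 c' D) hv hq hw35 hBL
  rw [← sumA6_eq c' χ hq s, ← lam1_prime_eq c' χ hq] at hmain
  set w : ℂ := (q : ℂ) ^ (-s) with hw_def
  set u : ℂ := (q : ℂ)⁻¹ with hu_def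
  set v : ℂ := χ (q : ZMod D) with hv_def
  set A : ℂ := 1 / (1 - v * u) - v / (1 - u) with hA_def
  set B : ℝ := (|b1 c' D| + |b2 c' D|) * Real.log q with hB_def
  have h1u : (1 : ℂ) - u ≠ 0 := by
    have h := one_sub_ne_zero hu (v := 1) (by simp)
    simpa using h
  have h1vu : (1 : ℂ) - v * u ≠ 0 := one_sub_ne_zero hu hv
  have hMainEq := mainA6Val_at_u (K := ℂ) h1u h1vu (v := v)
  -- main term: 1 + (1−vu)A(u/(1−u)) = 1/(1−u) − uv(1−vu)/(1−u)²
  have e : 1 + lam1 c' χ q 1 * sumA6 c' χ q s -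
      (1 / (1 - u) - u * v * (1 - v * u) / (1 - u) ^ 2) =
      (1 + lam1 c' χ q 1 * sumA6 c' χ q s - (1 + (1 - v * u) * A * (w / (1 - w)))) +
        (1 - v * u) * A * (w / (1 - w) - u / (1 - u)) := by
    rw [← hMainEq]; ring
  rw [e]
  have h1vu' : ‖(1 : ℂ) - v * u‖ ≤ 3 / 2 := by
    calc ‖(1 : ℂ) - v * u‖ ≤ ‖(1 : ℂ)‖ + ‖v * u‖ := norm_sub_le _ _
      _ ≤ 1 + 1 * (1 / 2) := by rw [norm_one, norm_mul]; gcongr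
      _ = 3 / 2 := by norm_num
  have hA4 : ‖A‖ ≤ 4 := by
    have hvu : ‖v * u‖ ≤ 1 / 2 := by rw [hu_def]; exact norm_mul_inv_le_half hv hq.two_le
    have hden : (1 : ℝ) / 2 ≤ ‖(1 : ℂ) - v * u‖ := by
      have := norm_sub_norm_le (1 : ℂ) (v * u); rw [norm_one] at this; linarith
    have hA1 : ‖(1 : ℂ) / (1 - v * u)‖ ≤ 2 := by
      rw [norm_div, norm_one]
      calc 1 / ‖(1 : ℂ) - v * u‖ ≤ 1 / (1 / 2) := by gcongr
        _ = 2 := by norm_num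
    have hA2 : ‖v / (1 - u)‖ ≤ 2 := norm_div_one_sub_le_two hu hv
    calc ‖A‖ ≤ ‖(1 : ℂ) / (1 - v * u)‖ + ‖v / (1 - u)‖ := norm_sub_le _ _
      _ ≤ 2 + 2 := by gcongr
      _ = 4 := by norm_num
  have hfrac := norm_div_one_sub_sub_le hw35 hu
  calc ‖(1 + lam1 c' χ q 1 * sumA6 c' χ q s - (1 + (1 - v * u) * A * (w / (1 - w)))) +
        (1 - v * u) * A * (w / (1 - w) - u / (1 - u))‖
      ≤ ‖1 + lam1 c' χ q 1 * sumA6 c' χ q s - (1 + (1 - v * u) * A * (w / (1 - w)))‖ +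
        ‖(1 - v * u) * A * (w / (1 - w) - u / (1 - u))‖ := norm_add_le _ _
    _ ≤ 153 * B * ‖w‖ + ‖(1 : ℂ) - v * u‖ * ‖A‖ * (5 * ‖w - u‖) := by
        rw [norm_mul, norm_mul]; gcongr
    _ ≤ 153 * ((4 * alpha D) * Real.log q) * (2 * (q : ℝ)⁻¹) +
        (3 / 2) * 4 * (5 * (10 * (q : ℝ)⁻¹ * (alpha D * Real.log q))) := by
        gcongr
        calc B = (|b1 c' D| + |b2 c' D|) * Real.log q := hB_def
          _ ≤ (4 * alpha D) * Real.log q := by gcongr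
    _ = 1524 * (alpha D * Real.log q / q) := by field_simp; ring

variable (c' : ℝ) in
/-- `StepA_u027` — `_holds` alias of `stepA_u027_holds` above under the fact's exact name, stated under the
prover's own binders as section variables (appended 2026-08-28, D-0026 bookkeeping: the proof term is the
existing theorem of this file; no statement, definition or attribute is edited; no new named fact; the
ledger's debt table listed the fact unproved). [cite: Zhang2022LandauSiegel, App. A p. 104 (proof of Lemma 15.2)] -/
theorem _root_.Literature.NumberTheory.LFunctions.Zhang2022.Typed.AppendixA2.StepA_u027_holds :
    _root_.Literature.NumberTheory.LFunctions.Zhang2022.Typed.AppendixA2.StepA_u027 c' :=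
  _root_.Literature.NumberTheory.LFunctions.Zhang2022.AppendixALocal.stepA_u027_holds (c' := c')

/-! ### §4. The prefactor of (A.4): `Z22:§A.u021` (second relation) -/

/-- The prefactor, locally: for `|u| ≤ 1/2`, `|v| ≤ 1`, `|w| ≤ 3/5`, `|y| ≤ 1` (any `x`),
**`|(1−wx)(1−wy)/((1−w)(1−vw)) − (1−u)/(1−vu)| ≤ 355|w − u| + 90|w|(|x−1| + |y−1|)`**
(`w = q^{−s}`, `u = q⁻¹`, `v = χ(q)`, `x = q^{−β₁}`, `y = q^{−β₂}`).
[cite: Zhang2022LandauSiegel, App. A p. 103 (proof of Lemma 15.2, first display)] -/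
theorem norm_prefactor_sub_le {u v w x y : ℂ} (hu : ‖u‖ ≤ 1 / 2) (hv : ‖v‖ ≤ 1) (hw : ‖w‖ ≤ 3 / 5)
    (hy : ‖y‖ ≤ 1) :
    ‖(1 - w * x) * (1 - w * y) / ((1 - w) * (1 - v * w)) - (1 - u) / (1 - v * u)‖ ≤
      355 * ‖w - u‖ + 90 * ‖w‖ * (‖x - 1‖ + ‖y - 1‖) := by
  -- non-vanishing and size of the denominators
  have h1u : (1 : ℝ) / 2 ≤ ‖1 - u‖ := by
    have := norm_sub_norm_le (1 : ℂ) u; rw [norm_one] at this; linarith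
  have h1vu : (1 : ℝ) / 2 ≤ ‖1 - v * u‖ := half_le_norm_one_sub hu hv
  have h1w : (2 : ℝ) / 5 ≤ ‖1 - w‖ := by
    have := norm_sub_norm_le (1 : ℂ) w; rw [norm_one] at this; linarith
  have h1vw : (2 : ℝ) / 5 ≤ ‖1 - v * w‖ := by
    have h' : ‖v * w‖ ≤ 3 / 5 := by
      rw [norm_mul]
      calc ‖v‖ * ‖w‖ ≤ 1 * (3 / 5) := by gcongr
        _ = 3 / 5 := by ring
    have := norm_sub_norm_le (1 : ℂ) (v * w); rw [norm_one] at this; linarith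
  have hu0 : (1 : ℂ) - u ≠ 0 := by intro h; rw [h, norm_zero] at h1u; linarith
  have hvu0 : (1 : ℂ) - v * u ≠ 0 := by intro h; rw [h, norm_zero] at h1vu; linarith
  have hw0 : (1 : ℂ) - w ≠ 0 := by intro h; rw [h, norm_zero] at h1w; linarith
  have hvw0 : (1 : ℂ) - v * w ≠ 0 := by intro h; rw [h, norm_zero] at h1vw; linarith
  -- upper bounds
  have hU1u : ‖(1 : ℂ) - u‖ ≤ 3 / 2 := by
    calc ‖(1 : ℂ) - u‖ ≤ ‖(1 : ℂ)‖ + ‖u‖ := norm_sub_le _ _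
      _ ≤ 1 + 1 / 2 := by rw [norm_one]; gcongr
      _ = 3 / 2 := by norm_num
  have hU1vu : ‖(1 : ℂ) - v * u‖ ≤ 3 / 2 := by
    calc ‖(1 : ℂ) - v * u‖ ≤ ‖(1 : ℂ)‖ + ‖v * u‖ := norm_sub_le _ _
      _ ≤ 1 + 1 * (1 / 2) := by rw [norm_one, norm_mul]; gcongr
      _ = 3 / 2 := by norm_num
  have hU1wy : ‖(1 : ℂ) - w * y‖ ≤ 8 / 5 := by
    calc ‖(1 : ℂ) - w * y‖ ≤ ‖(1 : ℂ)‖ + ‖w * y‖ := norm_sub_le _ _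
      _ ≤ 1 + 3 / 5 * 1 := by rw [norm_one, norm_mul]; gcongr
      _ = 8 / 5 := by norm_num
  have hU1vw : ‖(1 : ℂ) - v * w‖ ≤ 8 / 5 := by
    calc ‖(1 : ℂ) - v * w‖ ≤ ‖(1 : ℂ)‖ + ‖v * w‖ := norm_sub_le _ _
      _ ≤ 1 + 1 * (3 / 5) := by rw [norm_one, norm_mul]; gcongr
      _ = 8 / 5 := by norm_num
  -- the two elementary differences
  have hη1 : ‖(1 - w * x) - (1 - u)‖ ≤ ‖w - u‖ + ‖w‖ * ‖x - 1‖ := by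
    have e : (1 - w * x) - (1 - u) = -(w - u) + -(w * (x - 1)) := by ring
    rw [e]
    calc _ ≤ ‖-(w - u)‖ + ‖-(w * (x - 1))‖ := norm_add_le _ _
      _ = ‖w - u‖ + ‖w‖ * ‖x - 1‖ := by rw [norm_neg, norm_neg, norm_mul]
  have hη2 : ‖(1 - w * y) - (1 - u)‖ ≤ ‖w - u‖ + ‖w‖ * ‖y - 1‖ := by
    have e : (1 - w * y) - (1 - u) = -(w - u) + -(w * (y - 1)) := by ring
    rw [e]
    calc _ ≤ ‖-(w - u)‖ + ‖-(w * (y - 1))‖ := norm_add_le _ _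
      _ = ‖w - u‖ + ‖w‖ * ‖y - 1‖ := by rw [norm_neg, norm_neg, norm_mul]
  -- numerator and denominator differences
  set N : ℂ := (1 - w * x) * (1 - w * y) with hN
  set N₀ : ℂ := (1 - u) * (1 - u) with hN₀
  set Dn : ℂ := (1 - w) * (1 - v * w) with hDn
  set D₀ : ℂ := (1 - u) * (1 - v * u) with hD₀
  have hNN : ‖N - N₀‖ ≤ (8 / 5) * (2 * ‖w - u‖ + ‖w‖ * (‖x - 1‖ + ‖y - 1‖)) := by
    have e : N - N₀ = ((1 - w * x) - (1 - u)) * (1 - w * y) + (1 - u) * ((1 - w * y) - (1 - u)) := by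
      rw [hN, hN₀]; ring
    rw [e]
    calc _ ≤ ‖((1 - w * x) - (1 - u)) * (1 - w * y)‖ + ‖(1 - u) * ((1 - w * y) - (1 - u))‖ :=
          norm_add_le _ _
      _ = ‖(1 - w * x) - (1 - u)‖ * ‖1 - w * y‖ + ‖(1 : ℂ) - u‖ * ‖(1 - w * y) - (1 - u)‖ := by
          rw [norm_mul, norm_mul]
      _ ≤ (‖w - u‖ + ‖w‖ * ‖x - 1‖) * (8 / 5) + (3 / 2) * (‖w - u‖ + ‖w‖ * ‖y - 1‖) := by
          gcongr
      _ ≤ (8 / 5) * (2 * ‖w - u‖ + ‖w‖ * (‖x - 1‖ + ‖y - 1‖)) := by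
          nlinarith [norm_nonneg (w - u), norm_nonneg w, norm_nonneg (x - 1), norm_nonneg (y - 1),
            mul_nonneg (norm_nonneg w) (norm_nonneg (y - 1))]
  have hDD : ‖D₀ - Dn‖ ≤ (31 / 10) * ‖w - u‖ := by
    have e : D₀ - Dn = (w - u) * (1 - v * w) + (1 - u) * (v * (w - u)) := by
      rw [hDn, hD₀]; ring
    rw [e]
    calc _ ≤ ‖(w - u) * (1 - v * w)‖ + ‖(1 - u) * (v * (w - u))‖ := norm_add_le _ _
      _ = ‖w - u‖ * ‖1 - v * w‖ + ‖(1 : ℂ) - u‖ * (‖v‖ * ‖w - u‖) := by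
          rw [norm_mul, norm_mul, norm_mul]
      _ ≤ ‖w - u‖ * (8 / 5) + (3 / 2) * (1 * ‖w - u‖) := by gcongr
      _ = (31 / 10) * ‖w - u‖ := by ring
  have hN₀' : ‖N₀‖ ≤ 9 / 4 := by
    rw [hN₀, norm_mul]
    calc ‖(1 : ℂ) - u‖ * ‖(1 : ℂ) - u‖ ≤ (3 / 2) * (3 / 2) := by gcongr
      _ = 9 / 4 := by norm_num
  have hD₀' : ‖D₀‖ ≤ 9 / 4 := by
    rw [hD₀, norm_mul]
    calc ‖(1 : ℂ) - u‖ * ‖(1 : ℂ) - v * u‖ ≤ (3 / 2) * (3 / 2) := by gcongr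
      _ = 9 / 4 := by norm_num
  have hDn0 : Dn ≠ 0 := by rw [hDn]; exact mul_ne_zero hw0 hvw0
  have hD₀0 : D₀ ≠ 0 := by rw [hD₀]; exact mul_ne_zero hu0 hvu0
  have hDnlow : (4 : ℝ) / 25 ≤ ‖Dn‖ := by
    rw [hDn, norm_mul]
    calc (4 : ℝ) / 25 = 2 / 5 * (2 / 5) := by norm_num
      _ ≤ ‖1 - w‖ * ‖1 - v * w‖ := by gcongr
  have hD₀low : (1 : ℝ) / 4 ≤ ‖D₀‖ := by
    rw [hD₀, norm_mul]
    calc (1 : ℝ) / 4 = 1 / 2 * (1 / 2) := by norm_num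
      _ ≤ ‖1 - u‖ * ‖1 - v * u‖ := by gcongr
  -- the main identity
  have hmain0 : (1 - u) / (1 - v * u) = N₀ / D₀ := by
    rw [hN₀, hD₀, mul_div_mul_left _ _ hu0]
  have e : N / Dn - N₀ / D₀ = ((N - N₀) * D₀ + N₀ * (D₀ - Dn)) / (Dn * D₀) := by
    field_simp
    ring
  clear_value N N₀ Dn D₀
  have hgoal : ‖N / Dn - N₀ / D₀‖ ≤ 355 * ‖w - u‖ + 90 * ‖w‖ * (‖x - 1‖ + ‖y - 1‖) := by
    rw [e, norm_div, norm_mul]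
    have hden : (1 : ℝ) / 25 ≤ ‖Dn‖ * ‖D₀‖ := by
      calc (1 : ℝ) / 25 = 4 / 25 * (1 / 4) := by norm_num
        _ ≤ ‖Dn‖ * ‖D₀‖ := by gcongr
    have hnum : ‖(N - N₀) * D₀ + N₀ * (D₀ - Dn)‖ ≤
        (8 / 5) * (2 * ‖w - u‖ + ‖w‖ * (‖x - 1‖ + ‖y - 1‖)) * (9 / 4) + (9 / 4) * ((31 / 10) * ‖w - u‖) := by
      calc _ ≤ ‖(N - N₀) * D₀‖ + ‖N₀ * (D₀ - Dn)‖ := norm_add_le _ _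
        _ = ‖N - N₀‖ * ‖D₀‖ + ‖N₀‖ * ‖D₀ - Dn‖ := by rw [norm_mul, norm_mul]
        _ ≤ _ := by gcongr
    rw [div_le_iff₀ (by linarith)]
    have hE : 0 ≤ ‖w‖ * (‖x - 1‖ + ‖y - 1‖) := by positivity
    nlinarith [norm_nonneg (w - u), hden, hnum, hE,
      mul_le_mul_of_nonneg_left hden (by positivity : (0:ℝ) ≤ 355 * ‖w - u‖ + 90 * ‖w‖ * (‖x - 1‖ + ‖y - 1‖))]
  rw [hmain0]
  simpa only [hN, hDn] using hgoal

/-- The typed prefactor `zetaFactor1` in the local variables: `(1−wx)(1−wy)/((1−w)(1−vw))` with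
`w = q^{−s}`, `x = powI b₁ q`, `y = powI b₂ q`, `v = χ(q)`. [cite: Zhang2022LandauSiegel, App. A (A.4) p. 103] -/
theorem zetaFactor1_eq (c' : ℝ) {D : ℕ} [NeZero D] (χ : DirichletCharacter ℂ D) {q : ℕ}
    (hq : q.Prime) (s : ℂ) :
    zetaFactor1 c' χ q s =
      (1 - (q : ℂ) ^ (-s) * powI (b1 c' D) q) * (1 - (q : ℂ) ^ (-s) * powI (b2 c' D) q) /
        ((1 - (q : ℂ) ^ (-s)) * (1 - χ (q : ZMod D) * (q : ℂ) ^ (-s))) := by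
  have hq0 : (q : ℂ) ≠ 0 := by exact_mod_cast hq.ne_zero
  rw [zetaFactor1, neg_add, neg_add, Complex.cpow_add _ _ hq0, Complex.cpow_add _ _ hq0,
    cpow_neg_beta1 c' D hq.ne_zero, cpow_neg_beta2 c' D hq.ne_zero]

/-- **`Z22:§A.u021` (second relation) DISCHARGED**: for `D ≥ D₀(c′)`, every prime `q < D` and
`|s−1| < 5α`, `|zetaFactor1 − (1−q⁻¹)/(1−χ(q)q⁻¹)| ≤ 4270·α log q/q`.
[cite: Zhang2022LandauSiegel, App. A p. 103 (proof of Lemma 15.2, first display)] -/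
theorem stepA_u021b_holds (c' : ℝ) : Typed.AppendixA2.StepA_u021b c' := by
  refine ⟨4270, ForAllLarge.of_le (⌈Real.exp (7 * π * |c'| + 32)⌉₊ + 1) ?_⟩
  intro D _ χ hD _ _ _ q s hq hqD hs
  obtain ⟨-, hb, -, hα0⟩ := threshold c' hD
  obtain ⟨hwu, -, hw2, hw35, -, -⟩ := local_estimates c' hD hq hqD hs
  have hv : ‖χ (q : ZMod D)‖ ≤ 1 := χ.norm_le_one _
  have hu : ‖(q : ℂ)⁻¹‖ ≤ 1 / 2 := norm_inv_natCast_le_half hq.two_le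
  have hlog : 0 ≤ Real.log q := Real.log_natCast_nonneg q
  have hq0 : (0 : ℝ) < q := by exact_mod_cast hq.pos
  rw [zetaFactor1_eq c' χ hq]
  have h := norm_prefactor_sub_le hu hv hw35 (norm_powI_le_one (b2 c' D) q)
    (v := χ (q : ZMod D)) (x := powI (b1 c' D) q)
  have hx := MeanSquareMajorant.norm_powI_sub_one_le (b1 c' D) hq.pos
  have hy := MeanSquareMajorant.norm_powI_sub_one_le (b2 c' D) hq.pos
  calc _ ≤ 355 * ‖(q : ℂ) ^ (-s) - (q : ℂ)⁻¹‖ +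
        90 * ‖(q : ℂ) ^ (-s)‖ * (‖powI (b1 c' D) q - 1‖ + ‖powI (b2 c' D) q - 1‖) := h
    _ ≤ 355 * (10 * (q : ℝ)⁻¹ * (alpha D * Real.log q)) +
        90 * (2 * (q : ℝ)⁻¹) * (|b1 c' D| * Real.log q + |b2 c' D| * Real.log q) := by gcongr
    _ = 355 * (10 * (q : ℝ)⁻¹ * (alpha D * Real.log q)) +
        90 * (2 * (q : ℝ)⁻¹) * ((|b1 c' D| + |b2 c' D|) * Real.log q) := by ring
    _ ≤ 355 * (10 * (q : ℝ)⁻¹ * (alpha D * Real.log q)) +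
        90 * (2 * (q : ℝ)⁻¹) * ((4 * alpha D) * Real.log q) := by gcongr
    _ = 4270 * (alpha D * Real.log q / q) := by field_simp; ring

variable (c' : ℝ) in
/-- `StepA_u021b` — `_holds` alias of `stepA_u021b_holds` above under the fact's exact name, stated under the
prover's own binders as section variables (appended 2026-08-28, D-0026 bookkeeping: the proof term is the
existing theorem of this file; no statement, definition or attribute is edited; no new named fact; the
ledger's debt table listed the fact unproved). [cite: Zhang2022LandauSiegel, App. A p. 103 (proof of Lemma 15.2, first display)] -/
theorem _root_.Literature.NumberTheory.LFunctions.Zhang2022.Typed.AppendixA2.StepA_u021b_holds :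
    _root_.Literature.NumberTheory.LFunctions.Zhang2022.Typed.AppendixA2.StepA_u021b c' :=
  _root_.Literature.NumberTheory.LFunctions.Zhang2022.AppendixALocal.stepA_u021b_holds (c' := c')

/-- **(A.6) DISCHARGED** (`Z22:(A.6)`): for `D ≥ D₀(c′)`, every prime `q < D` with `(q,D) = 1` and
`|s−1| < 5α`, `|1 + λ₁(q)·sumA6 − (1−χ(q)q⁻¹)(1−χ(q)q⁻²)/((1−q⁻¹)(1−q⁻²))| ≤ 1524·α log q/q`.
[cite: Zhang2022LandauSiegel, App. A (A.6) p. 103] -/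
theorem eqA6_holds (c' : ℝ) : Typed.AppendixA2.EqA6 c' := by
  obtain ⟨C, D₀, h27⟩ := stepA_u027_holds c'
  refine ⟨C, D₀, fun D _ χ hD hq2 hprim hA q s hq hqD hcop hs => ?_⟩
  have h := h27 D χ hD hq2 hprim hA q s hq hqD hs
  have hv := chi_val_eq_one_or_neg_one χ hq2 hcop
  rw [Typed.AppendixA2.stepA_u028_holds D χ q hq hv] at h
  exact h

variable (c' : ℝ) in
/-- `EqA6` — `_holds` alias of `eqA6_holds` above under the fact's exact name, stated under the
prover's own binders as section variables (appended 2026-08-28, D-0026 bookkeeping: the proof term is the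
existing theorem of this file; no statement, definition or attribute is edited; no new named fact; the
ledger's debt table listed the fact unproved). [cite: Zhang2022LandauSiegel, App. A (A.6) p. 103] -/
theorem _root_.Literature.NumberTheory.LFunctions.Zhang2022.Typed.AppendixA2.EqA6_holds :
    _root_.Literature.NumberTheory.LFunctions.Zhang2022.Typed.AppendixA2.EqA6 c' :=
  _root_.Literature.NumberTheory.LFunctions.Zhang2022.AppendixALocal.eqA6_holds (c' := c')

/-- **(A.7) DISCHARGED** (`Z22:(A.7)`): for `D ≥ D₀(c′)`, every prime `q < D` with `q ∣ D` and
`|s−1| < 5α`, `|1 + λ₁(q)·sumA6 − 1/(1−q⁻¹)| ≤ 1524·α log q/q`.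
[cite: Zhang2022LandauSiegel, App. A (A.7) p. 104] -/
theorem eqA7_holds (c' : ℝ) : Typed.AppendixA2.EqA7 c' := by
  obtain ⟨C, D₀, h27⟩ := stepA_u027_holds c'
  refine ⟨C, D₀, fun D _ χ hD hq2 hprim hA q s hq hqD hdvd hs => ?_⟩
  have h := h27 D χ hD hq2 hprim hA q s hq hqD hs
  have hv := Typed.AppendixA1.chi_eq_zero_of_dvd χ hq hdvd
  rw [Typed.AppendixA2.stepA_u029_holds D χ q hq hv] at h
  exact h

variable (c' : ℝ) in
/-- `EqA7` — `_holds` alias of `eqA7_holds` above under the fact's exact name, stated under the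
prover's own binders as section variables (appended 2026-08-28, D-0026 bookkeeping: the proof term is the
existing theorem of this file; no statement, definition or attribute is edited; no new named fact; the
ledger's debt table listed the fact unproved). [cite: Zhang2022LandauSiegel, App. A (A.7) p. 104] -/
theorem _root_.Literature.NumberTheory.LFunctions.Zhang2022.Typed.AppendixA2.EqA7_holds :
    _root_.Literature.NumberTheory.LFunctions.Zhang2022.Typed.AppendixA2.EqA7 c' :=
  _root_.Literature.NumberTheory.LFunctions.Zhang2022.AppendixALocal.eqA7_holds (c' := c')

end Literature.NumberTheory.LFunctions.Zhang2022.AppendixALocal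

/-! ## The displayed steps `§A.u021`, `§A.u024` assembled (discharges of the typed conjunctions, in their home namespace) -/

namespace Literature.NumberTheory.LFunctions.Zhang2022.Typed.AppendixA2

/-- **`Z22:§A.u021` DISCHARGED as displayed** (both relations): the conjunction
`StepA_u021 c′ = StepA_u021a c′ ∧ StepA_u021b c′` of the first relation (`Typed.AppendixA2.stepA_u021a_holds`,
exact algebra) and the second (`AppendixALocal.stepA_u021b_holds` above).
[cite: Zhang2022LandauSiegel, App. A p. 103 (proof of Lemma 15.2, first display)] -/
theorem StepA_u021_holds : ∀ c' : ℝ, StepA_u021 c' :=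
  fun c' => ⟨stepA_u021a_holds c', AppendixALocal.stepA_u021b_holds c'⟩

/-- **`Z22:§A.u024` DISCHARGED as displayed** (all three relations): the conjunction
`StepA_u024 c′ = StepA_u024a c′ ∧ StepA_u024b c′ ∧ StepA_u024c` of `Typed.AppendixA2.stepA_u024a_holds`,
`stepA_u024b_holds` (`AppendixALemma152Steps`) and `Typed.AppendixA2.stepA_u024c_holds`.
[cite: Zhang2022LandauSiegel, App. A p. 104 (proof of Lemma 15.2)] -/
theorem StepA_u024_holds : ∀ c' : ℝ, StepA_u024 c' :=
  fun c' => ⟨stepA_u024a_holds c', AppendixALocal.stepA_u024b_holds c', stepA_u024c_holds⟩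

end Literature.NumberTheory.LFunctions.Zhang2022.Typed.AppendixA2
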